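import Literature.NumberTheory.Automorphic.ArchTorusOrbitalFunctionAtPoint     -- ★ junction (p839451): `continuousOn_archStableOrbitalIntegral_archDiagTorus_of_continuousOn`; brings ★ (V8)-glob∕orb
import Literature.NumberTheory.Automorphic.ArchTorusOrbitalContinuity          -- ★ (V2)-glob FILE B (p839464, F0P3a-p06): `continuousOn_integral_comp_conj_archDiagTorus`
import Literature.NumberTheory.Automorphic.ArchLocalSingularTorusClassesPlace  -- ★ (B-p17 (g23), p839558): `setOf_isConj_circleDiagonal_out_eq_range_of_conj` (ANY `z`, per place)
import HarnessLib

/-!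
# The archimedean stable class of an ARBITRARY torus point of `G′_∞ = U(diag α)(L⁺ ⊗ ℝ)` — singular `γ₀` included: the multiset criterion, the global list,
# `Φ^st_∞` as a finite sum, and the continuity of `Φ^st_∞` on `T_reg` (Rogawski 1990 §3.1 p. 19, §3.8 pp. 30–32, §4.1 (4.1.1) p. 39, §8.2 Prop. 8.2.1 p. 118)

Topic `NumberTheory/Automorphic`; namespace `Literature.NumberTheory.Automorphic.UnitaryGroup`.  THEOREMS ONLY (no definition, no instance, no notation, no named fact, no `sorry`).
Cell `pub/hodgecm-mathlib`, ENGINE T1 (crux H413 = `stmt-HodgeConjecture-24833`); floor-1 preparation, count-neutral, under books rows #88 (ST-∞) ∕ #111 (S-d): road D2′, brick **«(o1)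
SINGULAR GLOBAL TWIN»** of ★ (V8)-glob `ArchStableClassRegularTorus` (p838902, regular `z`) (LEAD WORDS T7-44∕T7-63∕T8-1 (G); author F0P3a-p02 (g9)), BY IMPORT over B-p17 (g23)'s ★
`ArchLocalSingularTorusClassesPlace` (p839558: PER PLACE the classes of the stable class of ANY `diag(z)` are the classes of the `diag(z ∘ ρ)` — his exhaustion ★
`exists_perm_conj_circleDiagonal_eq_of_conj_eq`, (V8)-exh), ★ (V8)-glob FILE 1 `ArchStableConjugacyLocalGlobal` (p838845: placewise criteria (g1)(g2)), ★ junction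
`ArchTorusOrbitalFunctionAtPoint` (p839451) and ★ (V2)-glob FILE B `ArchTorusOrbitalContinuity` (p839464, F0P3a-p06).  Carrier (token-exact): the `∑ᶠ` index set of ★
`archStableOrbitalIntegral L N (diagonal α) m a (archDiagTorus L N α z)` (`Rogawski1990/ArchimedeanTransfer.lean` :209–220).

WHAT IS PROVED.
* §1 (any field, any finite index type) **`exists_perm_of_charpoly_diagonal_eq`** — two diagonal matrices with the same characteristic polynomial differ by a permutation of the
  diagonal (`charpoly_diagonal`, `roots_multiset_prod_X_sub_C`, `Multiset.count_map`, `Equiv.ofFiberEquiv`; a `private` twin lives in ★ `RealSimultaneousDiagonalization`, not importable),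
  `exists_perm_of_units_conj_diagonal`.
* §2 per place **`isStablyConj_circleDiagonal_iff_exists_perm_of_conj`** — `diag(z) ∼_st diag(z′)` in `G_w` iff `z′ = z ∘ ρ`, for ARBITRARY `z` (`⇐` = F0P3a-p06's ★
  `monomial_conj_circleDiagonal`).
* §3 GLOBAL, ARBITRARY `z` (`α_i ≠ 0`, `c α_i = α_i`): **`isStablyConj_archDiagTorus_iff_exists_of_conj`**, **`exists_isConj_archDiagTorus_of_isStablyConj_of_conj`** (EXHAUSTION in
  `G′_∞`), **`conjClasses_stable_archDiagTorus_eq_range_of_conj`** + `finite_…_of_conj` (the stable class of `t(z)` = `range (ρ ↦ ⟦t(w ↦ z_w ∘ ρ_w)⟧)`, finite), **(s4)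
  `archStableOrbitalIntegral_archDiagTorus_eq_sum_of_conj`** (`Φ^st_∞(t z, a) = Σ_{q ∈ univ.image (ρ ↦ ⟦t(z∘ρ)⟧)} Φ(q, a)` for EVERY `m`, `a` — the UNSIGNED sum; Kottwitz signs
  enter through `a ↦ e·a`, ★ `kottwitzSignArchWeight`).  The regular heads of ★ p838902 are the special case (not restated).
* §4 **`continuousOn_archStableOrbitalIntegral_archDiagTorus`** — `z ↦ Φ^st_∞(t(z), a)` is CONTINUOUS ON `T_reg` for `a ∈ C_c(G′_∞)` and `m` canonical on the regular classes for
  the Haar measure `ν` (★ junction (j3) discharged by F0P3a-p06's ★ `continuousOn_integral_comp_conj_archDiagTorus`; any signatures).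
NOT HERE: the class COUNT at a singular `z` as a product over places (per place ★ B-p17 `ncard_… = 2` for `diag(a,a,b)` at `(2,1)`); `Φ^st_∞` at singular points as honest
point orbital integrals (the centralisers `U(1,1) × U(1)` are NOT compact — (S-d)'s compatible-measure datum, floor 2).
HONEST LABEL: HC_CM is proved only modulo the printed citations until rung 0 closes; this file is group-theoretic book-keeping and pays nothing by itself.

## References
* [Rogawski1990] J. D. Rogawski, *Automorphic Representations of Unitary Groups in Three Variables*, Ann. of Math. Stud. 123 (1990): §3.1 p. 19 (stable conjugacy = same
  characteristic polynomial), §3.8 pp. 30–32, Prop. 3.8.1 (classes within a singular stable class), §4.1 (4.1.1)–(4.1.2) pp. 39–40, §8.2 Prop. 8.2.1 p. 118 (`γ₀`, `γ₀′`; `γ, γ₁, γ₂`).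
* [BorelJacquet1979] A. Borel, H. Jacquet, *Automorphic forms and automorphic representations*, PSPM 33.1 (1979), §4.1.
* [BrockerTomDieck1985] Th. Bröcker, T. tom Dieck, *Representations of Compact Lie Groups*, GTM 98 (1985), Ch. IV (3.2).
* [Shelstad1979] D. Shelstad, *Characters and inner forms of a quasi-split group over ℝ*, Compositio Math. 39 (1979), §4.
-/

set_option autoImplicit false

noncomputable section

open MeasureTheory Measure Matrix Equiv NumberField NumberField.InfinitePlace NumberField.mixedEmbedding Polynomial
open scoped MatrixGroups ComplexConjugate

namespace Literature.NumberTheory.Automorphic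

namespace UnitaryGroup

open Literature.LinearAlgebra.Matrix Literature.NumberTheory.Rogawski1990

/-! ## §1 Two diagonal matrices are `GL_n`-conjugate iff their entries differ by a permutation — no injectivity (multiset of eigenvalues) -/

section Multiset

variable {n : Type*} [Fintype n] [DecidableEq n] {K : Type*} [Field K] [DecidableEq K]

/-- **Equal characteristic polynomials of two diagonal matrices ⇒ the diagonals differ by a permutation** (the roots multisets `{z_i}` and `{z′_i}` coincide:
Mathlib `charpoly_diagonal`, `roots_multiset_prod_X_sub_C`, `Multiset.count_map`; the permutation is `Equiv.ofFiberEquiv` of the fibre bijections).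
[cite: Rogawski1990, §3.1 p. 19] [cite: BrockerTomDieck1985, Ch. IV (3.2)] -/
theorem exists_perm_of_charpoly_diagonal_eq {z z' : n → K} (h : (Matrix.diagonal z).charpoly = (Matrix.diagonal z').charpoly) :
    ∃ ρ : Perm n, z' = z ∘ ρ := by
  -- the multisets of diagonal entries agree
  have hm : (Finset.univ.val.map z : Multiset K) = Finset.univ.val.map z' := by
    have hr : ∀ u : n → K, (Matrix.diagonal u).charpoly.roots = Finset.univ.val.map u := fun u => by
      rw [Matrix.charpoly_diagonal]
      have : (∏ i : n, (X - C (u i))) = ((Finset.univ.val.map u).map fun a => X - C a).prod := by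
        rw [Multiset.map_map, Finset.prod_eq_multiset_prod]; rfl
      rw [this, roots_multiset_prod_X_sub_C]
    rw [← hr z, ← hr z', h]
  -- hence all fibres have the same size, and `ofFiberEquiv` of fibre bijections is the permutation
  have hfib : ∀ c : K, Fintype.card {i // z' i = c} = Fintype.card {i // z i = c} := fun c => by
    have h1 := congrArg (Multiset.count c) hm
    rw [Multiset.count_map, Multiset.count_map] at h1
    rw [Fintype.card_subtype, Fintype.card_subtype]
    have e1 : (Finset.univ.filter fun i => z' i = c).card = Multiset.card (Finset.univ.val.filter fun a => c = z' a) := by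
      rw [← Finset.filter_val, Finset.card_val]; congr 1; ext i; simp only [Finset.mem_filter, Finset.mem_univ, true_and]; exact eq_comm
    have e2 : (Finset.univ.filter fun i => z i = c).card = Multiset.card (Finset.univ.val.filter fun a => c = z a) := by
      rw [← Finset.filter_val, Finset.card_val]; congr 1; ext i; simp only [Finset.mem_filter, Finset.mem_univ, true_and]; exact eq_comm
    rw [e1, e2, h1]
  refine ⟨Equiv.ofFiberEquiv (f := z') (g := z) fun c => Fintype.equivOfCardEq (hfib c), funext fun i => ?_⟩
  exact (Equiv.ofFiberEquiv_map (f := z') (g := z) (fun c => Fintype.equivOfCardEq (hfib c)) i).symm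

/-- **`diag(z) ∼_{GL_n} diag(z′) ⇒ z′ = z ∘ ρ`** for ARBITRARY `z` (conjugate matrices have the same characteristic polynomial). [cite: Rogawski1990, §3.1 p. 19] -/
theorem exists_perm_of_units_conj_diagonal {z z' : n → K} (g : GL n K)
    (h : (g : Matrix n n K) * Matrix.diagonal z * (g⁻¹ : GL n K) = Matrix.diagonal z') : ∃ ρ : Perm n, z' = z ∘ ρ := by
  refine exists_perm_of_charpoly_diagonal_eq ?_
  rw [← h, Matrix.coe_units_inv, Matrix.charpoly_units_conj]

end Multiset

/-! ## §2 PER PLACE: stable conjugacy of ARBITRARY circle-torus points = relabelling -/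

section Place

variable (L : Type) [Field L] (N : ℕ) (α : Fin N → L) (w : {w : InfinitePlace L // IsComplex w})

/-- **`diag(z) ∼_st diag(z′)` in `G_w` iff `z′ = z ∘ ρ` — for ARBITRARY `z`** (singular torus points included; the regular case is ★ `isStablyConj_circleDiagonal_iff_exists_perm`):
`⇒` by §1 (multiset of eigenvalues), `⇐` is F0P3a-p06's ★ `monomial_conj_circleDiagonal`. [cite: Rogawski1990, §3.1 p. 19; §3.8 pp. 30–32] [cite: BrockerTomDieck1985, Ch. IV (3.2)] -/
theorem isStablyConj_circleDiagonal_iff_exists_perm_of_conj (z z' : Fin N → Circle) :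
    IsStablyConj (starRingEnd ℂ) ((diagonal α).map w.1.embedding)
        (⟨circleDiagonal N z, circleDiagonal_mem_archLocal_diagonal L N α w z⟩ : archLocal L N (diagonal α) w)
        ⟨circleDiagonal N z', circleDiagonal_mem_archLocal_diagonal L N α w z'⟩ ↔
      ∃ ρ : Perm (Fin N), z' = z ∘ ρ := by
  constructor
  · intro h
    obtain ⟨g, hg⟩ := isStablyConj_iff.1 h
    have hmat := congrArg (fun u : GL (Fin N) ℂ => (u : Matrix (Fin N) (Fin N) ℂ)) hg
    simp only [Units.val_mul, coe_circleDiagonal] at hmat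
    obtain ⟨ρ, hρ⟩ := exists_perm_of_units_conj_diagonal (K := ℂ) g hmat
    refine ⟨ρ, funext fun i => Circle.ext ?_⟩
    have h1 := congrFun hρ i
    simp only [Function.comp_apply] at h1 ⊢
    exact h1
  · rintro ⟨ρ, rfl⟩
    refine isStablyConj_iff.2 ⟨Matrix.GeneralLinearGroup.mkOfDetNeZero _ (det_monomial_one_ne_zero N ρ.symm), ?_⟩
    have h1 := monomial_conj_circleDiagonal N ρ.symm z
    simp only [Equiv.symm_symm] at h1
    simpa only [Function.comp_def] using h1

end Place

/-! ## §3 GLOBAL `G′_∞ = U(diag α)(L⁺ ⊗ ℝ)`: the stable class of an ARBITRARY torus point, listed; `Φ^st_∞` at it as a finite sum -/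

section Torus

variable (L : Type) [Field L] [NumberField L] [IsCMField L] (N : ℕ) (α : Fin N → L)

/-- **`t(z) ∼_st t(z′)` in `G′_∞` iff `z′_w = z_w ∘ ρ_w` at every place — ARBITRARY `z`** (★ (g1) `isStablyConj_arch_iff_forall_place` + §2; regular case ★
`isStablyConj_archDiagTorus_iff_exists`). [cite: Rogawski1990, §3.1 p. 19; §3.8 pp. 30–32] [cite: BorelJacquet1979, §4.1] -/
theorem isStablyConj_archDiagTorus_iff_exists_of_conj (z z' : {w : InfinitePlace L // IsComplex w} → Fin N → Circle) :
    IsStablyConj (conjMixed (↥(maximalRealSubfield L)) L (IsCMField.complexConj L)) (archFormOf L N (diagonal α))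
        (archDiagTorus L N α z) (archDiagTorus L N α z') ↔
      ∃ ρ : {w : InfinitePlace L // IsComplex w} → Perm (Fin N), z' = fun w => z w ∘ ρ w := by
  rw [isStablyConj_arch_iff_forall_place]
  simp only [archPiEquivCM_archDiagTorus]
  constructor
  · intro h
    choose ρ hρ using fun w => (isStablyConj_circleDiagonal_iff_exists_perm_of_conj L N α w (z w) (z' w)).mp (h w)
    exact ⟨ρ, funext hρ⟩
  · rintro ⟨ρ, rfl⟩ w
    exact (isStablyConj_circleDiagonal_iff_exists_perm_of_conj L N α w (z w) _).mpr ⟨ρ w, rfl⟩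

/-- **EXHAUSTION IN `G′_∞` AT AN ARBITRARY TORUS POINT**: every `δ ∈ U(diag α)(L⁺ ⊗ ℝ)` stably conjugate to `t(z)` (`z` ANY — e.g. the split-singular `γ₀`) is conjugate in `G′_∞` to a
relabelled torus point `t(w ↦ z_w ∘ ρ_w)` (per place: B-p17 (g23)'s ★ exhaustion `setOf_isConj_circleDiagonal_out_eq_range_of_conj`, glued by ★ (g2)).
[cite: Rogawski1990, §3.8 pp. 30–32 (Prop. 3.8.1); §8.2 Prop. 8.2.1 p. 118] [cite: BorelJacquet1979, §4.1] -/
theorem exists_isConj_archDiagTorus_of_isStablyConj_of_conj (hα : ∀ i, α i ≠ 0) (hherm : ∀ i, (IsCMField.complexConj L (α i) : L) = α i)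
    (z : {w : InfinitePlace L // IsComplex w} → Fin N → Circle)
    (δ : arch (↥(maximalRealSubfield L)) L (IsCMField.complexConj L) N (diagonal α))
    (h : IsStablyConj (conjMixed (↥(maximalRealSubfield L)) L (IsCMField.complexConj L)) (archFormOf L N (diagonal α)) (archDiagTorus L N α z) δ) :
    ∃ ρ : {w : InfinitePlace L // IsComplex w} → Perm (Fin N), IsConj (archDiagTorus L N α fun w => z w ∘ ρ w) δ := by
  rw [isStablyConj_arch_iff_forall_place] at h
  simp only [archPiEquivCM_archDiagTorus] at h
  -- per place: the class of `δ_w` lies in the list of classes of the relabelled torus points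
  have hmem : ∀ w : {w : InfinitePlace L // IsComplex w},
      ConjClasses.mk (archPiEquivCM N L (diagonal α) δ w) ∈
        Set.range fun ρ : Perm (Fin N) =>
          ConjClasses.mk (⟨circleDiagonal N (z w ∘ ρ), circleDiagonal_mem_archLocal_diagonal L N α w (z w ∘ ρ)⟩ : archLocal L N (diagonal α) w) := fun w => by
    rw [← conjClasses_stable_circleDiagonal_eq_range_of_conj L N α w hα (im_embedding_diagonal_eq_zero L N α hherm w) (z w), Set.mem_setOf_eq]
    exact (h w).trans (isStablyConj_of_isConj (ConjClasses.mk_eq_mk_iff_isConj.mp (Quotient.out_eq _).symm))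
  choose ρ hρ using hmem
  refine ⟨ρ, (isConj_arch_iff_forall_place L N (diagonal α) _ _).mpr fun w => ?_⟩
  rw [archPiEquivCM_archDiagTorus]
  exact ConjClasses.mk_eq_mk_iff_isConj.mp (hρ w)

/-- **THE ARCHIMEDEAN STABLE CLASS OF AN ARBITRARY TORUS POINT, LISTED**: exactly the classes of `t(w ↦ z_w ∘ ρ_w)`, `ρ ∈ Π_w S_N` — the index set of the `∑ᶠ` in ★
`archStableOrbitalIntegral L N (diagonal α) m a (t z)` at EVERY elliptic torus point, the singular `γ₀` of (ST-∞) included (regular case ★ `conjClasses_stable_archDiagTorus_eq_range`).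
[cite: Rogawski1990, §4.1 (4.1.1) p. 39; §3.8 pp. 30–32 (Prop. 3.8.1)] [cite: BorelJacquet1979, §4.1] -/
theorem conjClasses_stable_archDiagTorus_eq_range_of_conj (hα : ∀ i, α i ≠ 0) (hherm : ∀ i, (IsCMField.complexConj L (α i) : L) = α i)
    (z : {w : InfinitePlace L // IsComplex w} → Fin N → Circle) :
    {q : ConjClasses ↥(arch (↥(maximalRealSubfield L)) L (IsCMField.complexConj L) N (diagonal α)) |
        IsStablyConj (conjMixed (↥(maximalRealSubfield L)) L (IsCMField.complexConj L)) (archFormOf L N (diagonal α))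
          (archDiagTorus L N α z) (Quotient.out q)} =
      Set.range fun ρ : {w : InfinitePlace L // IsComplex w} → Perm (Fin N) => ConjClasses.mk (archDiagTorus L N α fun w => z w ∘ ρ w) := by
  ext q
  rw [Set.mem_setOf_eq, Set.mem_range]
  constructor
  · intro hq
    obtain ⟨ρ, hρ⟩ := exists_isConj_archDiagTorus_of_isStablyConj_of_conj L N α hα hherm z _ hq
    exact ⟨ρ, (ConjClasses.mk_eq_mk_iff_isConj.mpr hρ).trans (Quotient.out_eq q)⟩
  · rintro ⟨ρ, rfl⟩
    have h1 : IsConj (archDiagTorus L N α fun w => z w ∘ ρ w)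
        (Quotient.out (ConjClasses.mk (archDiagTorus L N α fun w => z w ∘ ρ w)) : _) :=
      ConjClasses.mk_eq_mk_iff_isConj.mp (Quotient.out_eq (ConjClasses.mk (archDiagTorus L N α fun w => z w ∘ ρ w))).symm
    exact ((isStablyConj_archDiagTorus_iff_exists_of_conj L N α z _).mpr ⟨ρ, rfl⟩).trans (isStablyConj_of_isConj h1)

/-- The archimedean stable class of EVERY torus point meets finitely many classes (at most `(N!)^{#W}`). [cite: Rogawski1990, §4.1 (4.1.1) p. 39] -/
theorem finite_conjClasses_stable_archDiagTorus_of_conj (hα : ∀ i, α i ≠ 0) (hherm : ∀ i, (IsCMField.complexConj L (α i) : L) = α i)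
    (z : {w : InfinitePlace L // IsComplex w} → Fin N → Circle) :
    {q : ConjClasses ↥(arch (↥(maximalRealSubfield L)) L (IsCMField.complexConj L) N (diagonal α)) |
        IsStablyConj (conjMixed (↥(maximalRealSubfield L)) L (IsCMField.complexConj L)) (archFormOf L N (diagonal α))
          (archDiagTorus L N α z) (Quotient.out q)}.Finite := by
  rw [conjClasses_stable_archDiagTorus_eq_range_of_conj L N α hα hherm z]
  exact Set.finite_range _

variable [∀ g : ↥(arch (↥(maximalRealSubfield L)) L (IsCMField.complexConj L) N (diagonal α)),
    MeasurableSpace (↥(arch (↥(maximalRealSubfield L)) L (IsCMField.complexConj L) N (diagonal α)) ⧸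
      Subgroup.centralizer ({g} : Set ↥(arch (↥(maximalRealSubfield L)) L (IsCMField.complexConj L) N (diagonal α))))]

open scoped Classical in
/-- **`Φ^st_∞(t(z), a) = Σ_{q ∈ univ.image (ρ ↦ ⟦t(z∘ρ)⟧)} Φ(q, a)` AT AN ARBITRARY TORUS POINT** — every family `m`, every `a`: the UNSIGNED stable sum of LETTER #4 that the (ST-∞) ∕
κ letters read at the split-singular `γ₀` (the Kottwitz signs enter through `a ↦ e·a`, ★ `kottwitzSignArchWeight`); regular case ★ `archStableOrbitalIntegral_archDiagTorus_eq_sum`.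
[cite: Rogawski1990, §4.1 (4.1.1)–(4.1.2) pp. 39–40; §8.2 Prop. 8.2.1 p. 118] -/
theorem archStableOrbitalIntegral_archDiagTorus_eq_sum_of_conj (hα : ∀ i, α i ≠ 0) (hherm : ∀ i, (IsCMField.complexConj L (α i) : L) = α i)
    (z : {w : InfinitePlace L // IsComplex w} → Fin N → Circle)
    (m : OrbitalMeasureFamily ↥(arch (↥(maximalRealSubfield L)) L (IsCMField.complexConj L) N (diagonal α)))
    (a : ↥(arch (↥(maximalRealSubfield L)) L (IsCMField.complexConj L) N (diagonal α)) → ℂ) :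
    archStableOrbitalIntegral L N (diagonal α) m a (archDiagTorus L N α z) =
      ∑ q ∈ Finset.univ.image (fun ρ : {w : InfinitePlace L // IsComplex w} → Perm (Fin N) => ConjClasses.mk (archDiagTorus L N α fun w => z w ∘ ρ w)),
        classOrbitalIntegral m a q := by
  rw [archStableOrbitalIntegral_eq_finset_sum_of_finite L N (diagonal α) m a _ (finite_conjClasses_stable_archDiagTorus_of_conj L N α hα hherm z)]
  refine Finset.sum_congr ?_ fun _ _ => rfl
  apply Finset.coe_injective
  rw [Set.Finite.coe_toFinset]
  exact (conjClasses_stable_archDiagTorus_eq_range_of_conj L N α hα hherm z).trans (by rw [Finset.coe_image, Finset.coe_univ, Set.image_univ])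

/-! ## §4 Continuity of `z ↦ Φ^st_∞(t(z), a)` on the regular torus — UNCONDITIONAL over ★ (V2)-glob FILE B -/

variable [MeasurableSpace (arch (↥(maximalRealSubfield L)) L (IsCMField.complexConj L) N (diagonal α))]
  [BorelSpace (arch (↥(maximalRealSubfield L)) L (IsCMField.complexConj L) N (diagonal α))]
  [∀ g : ↥(arch (↥(maximalRealSubfield L)) L (IsCMField.complexConj L) N (diagonal α)),
    BorelSpace (↥(arch (↥(maximalRealSubfield L)) L (IsCMField.complexConj L) N (diagonal α)) ⧸
      Subgroup.centralizer ({g} : Set ↥(arch (↥(maximalRealSubfield L)) L (IsCMField.complexConj L) N (diagonal α))))]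

/-- **`z ↦ Φ^st_∞(t(z), a)` IS CONTINUOUS ON `T_reg = {z ∣ ∀ w, z_w injective}`** for `a ∈ C_c(G′_∞)` and a family `m` canonical on the regular classes for the Haar measure `ν` of
`G′_∞` — ★ junction (j3) `continuousOn_archStableOrbitalIntegral_archDiagTorus_of_continuousOn` with `hF :=` F0P3a-p06's ★ (V2)-glob `continuousOn_integral_comp_conj_archDiagTorus`
(p839464).  The (L-cont) input for the global stable orbital integral, any signatures. [cite: Rogawski1990, §8.2 Prop. 8.2.1 p. 118] [cite: Shelstad1979, §4] -/
theorem continuousOn_archStableOrbitalIntegral_archDiagTorus (hα : ∀ i, α i ≠ 0) (hherm : ∀ i, (IsCMField.complexConj L (α i) : L) = α i)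
    {ν : Measure (arch (↥(maximalRealSubfield L)) L (IsCMField.complexConj L) N (diagonal α))} [ν.IsHaarMeasure] [ν.IsMulRightInvariant]
    {m : OrbitalMeasureFamily ↥(arch (↥(maximalRealSubfield L)) L (IsCMField.complexConj L) N (diagonal α))}
    (hm : m.IsCanonical (fun γ => IsRegularElt (γ.val : GL (Fin N) (mixedSpace L))) ν)
    (a : arch (↥(maximalRealSubfield L)) L (IsCMField.complexConj L) N (diagonal α) → ℂ) (ha : Continuous a) (hac : HasCompactSupport a) :
    ContinuousOn (fun z : {w : InfinitePlace L // IsComplex w} → Fin N → Circle => archStableOrbitalIntegral L N (diagonal α) m a (archDiagTorus L N α z))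
      {z | ∀ w, Function.Injective (z w)} :=
  continuousOn_archStableOrbitalIntegral_archDiagTorus_of_continuousOn L N α hα hherm hm a ha
    (continuousOn_integral_comp_conj_archDiagTorus L N α hα ν a ha hac)

end Torus

end UnitaryGroup

end Literature.NumberTheory.Automorphic

end
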